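import Mathlib
import Summits.ResolutionOfSingularities.ResolutionOfSingularities.Theorems.SyzygyFlatteningDefs
import Summits.ResolutionOfSingularities.ResolutionOfSingularities.Theorems.SyzygyFlatteningHigherRankTerminationTowerStageBasic
import Literature.AlgebraicGeometry.Resolution.RankOneReductionProofs
import Literature.AlgebraicGeometry.Resolution.LocalBlowup
import HarnessLib

/-!
# The localisation `locAt O B` at the centre of a valuation: basic API and `stub_locAt_locAt`

Crux `HigherRankTermination` (stmt-ResolutionOfSingularities-17045), line `birth`, registered
stub `stub_locAt_locAt`, together with the elementary API of the route's operator
`locAt O B = k[{a * s⁻¹ | a, s ∈ B, s⁻¹ ∈ O}]` (`Theorems/SyzygyFlatteningDefs.lean`) for a model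
`B ⊆ O`:

* `locAt_toSubring_eq_locAtCentre` — THE BRIDGE: as a subring, `locAt O B` is the tree's
  `locAtCentre B.toSubring O` (`Literature/…/LocalBlowup.lean`: the fractions `y / z`, `y, z ∈ B`,
  `O.valuation z = 1`), which carries `IsLocalRing`, `IsLocalization.AtPrime _ (centre)`,
  idempotence, monotonicity and the regularity transfer to `Localization.AtPrime (centre)`;
* `mem_locAt_iff` — `y ∈ locAt O B ↔ ∃ a ∈ B, ∃ s ∈ B, O.valuation s = 1 ∧ y = a * s⁻¹`;
* `coe_locAt_eq_centreLocalization` — the carrier of `locAt O B` is that of Mathlib's realised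
  localisation `Localization.subalgebra.ofField K (centre).primeCompl _` of
  `RankOneReductionProofs.lean` (`mem_centreLocalization_iff`), for `Frac B = K`;
* `locAt_le` (`locAt O B ⊆ O`, no `k ⊆ O` hypothesis needed), `locAt_mono`,
  `locAt_le_locAt_of_le` (monotone in the valuation ring along coarsenings `O ≤ O₁`),
  `inv_mem_locAt`, `isLocalRing_locAt`, `isRegularLocalRing_locAt_iff`,
  `isRegularLocalRing_locAt_iff_atPrime` (`B ≤ locAt O B` is `self_le_locAt` of
  `SyzygyFlatteningHigherRankTerminationTowerStageBasic.lean`);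
* `stub_locAt_locAt` — `locAt O₁ (locAt O B) = locAt O₁ B` for `B ⊆ O ≤ O₁`
  (`(B_𝔪)_𝔭 = B_𝔭` inside `K`; at `O₁ = O` the idempotence of `locAt O`).

All of this is folklore (Novacoski–Spivakovsky 2014, Lemma 2.5 and Def. 2.8, is the printed
form of the bridge and of the idempotence).
-/

noncomputable section

-- single-problem summit: the doubled namespace component `ResolutionOfSingularities` is forced
set_option linter.dupNamespace false

namespace Summit.ResolutionOfSingularities.ResolutionOfSingularities.Theorems.SyzygyFlattening

open IsLocalRing Literature.AlgebraicGeometry.Resolution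

variable {k K : Type} [Field k] [Field K] [Algebra k K]

/-! ## Generators, without any hypothesis on `B` -/

/-- `locAt O B` unfolds to `k[{a * s⁻¹ | a, s ∈ B, s⁻¹ ∈ O}]`. [folklore] -/
theorem locAt_def (O : ValuationSubring K) (B : Subalgebra k K) :
    locAt O B = Algebra.adjoin k {y : K | ∃ a ∈ B, ∃ s ∈ B, s⁻¹ ∈ O ∧ y = a * s⁻¹} :=
  rfl

/-- A fraction `a * s⁻¹` with `a, s ∈ B`, `s⁻¹ ∈ O` lies in `locAt O B` (it is a generator).
[folklore] -/
theorem mul_inv_mem_locAt (O : ValuationSubring K) (B : Subalgebra k K) {a s : K} (ha : a ∈ B)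
    (hs : s ∈ B) (hsO : s⁻¹ ∈ O) : a * s⁻¹ ∈ locAt O B :=
  Algebra.subset_adjoin ⟨a, ha, s, hs, hsO, rfl⟩

/-- `locAt O` is monotone in the model: `B ≤ C → locAt O B ≤ locAt O C`. [folklore] -/
theorem locAt_mono (O : ValuationSubring K) {B C : Subalgebra k K} (h : B ≤ C) :
    locAt O B ≤ locAt O C :=
  Algebra.adjoin_mono fun _ ⟨a, ha, s, hs, hsO, hy⟩ => ⟨a, h ha, s, h hs, hsO, hy⟩

/-! ## Units of a valuation ring and coarsenings -/

/-- An element of `O` whose inverse lies in `O` is an `O`-unit: `O.valuation s = 1`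
(the value form of `isUnit_of_inv_mem`, `CompositeValuations.lean`). [folklore] -/
theorem valuation_eq_one_of_inv_mem (O : ValuationSubring K) {s : K} (hs : s ∈ O)
    (hsi : s⁻¹ ∈ O) (hs0 : s ≠ 0) : O.valuation s = 1 :=
  (O.valuation_eq_one_iff ⟨s, hs⟩).mp (isUnit_of_inv_mem O hs hsi hs0)

/-- `O`-units are `O₁`-units for a coarsening `O ≤ O₁`: `O.valuation s = 1 → O₁.valuation s = 1`.
[folklore] -/
theorem valuation_eq_one_of_le (O O₁ : ValuationSubring K) (hO : O ≤ O₁) {s : K}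
    (hs : O.valuation s = 1) : O₁.valuation s = 1 := by
  have hs0 : s ≠ 0 := ne_zero_of_valuation_eq_one hs
  have hsO : s ∈ O := (O.valuation_le_one_iff s).mp hs.le
  have hsiO : s⁻¹ ∈ O := inv_mem_of_valuation_eq_one O hs
  exact valuation_eq_one_of_inv_mem O₁ (hO hsO) (hO hsiO) hs0

/-! ## The bridge to `locAtCentre` and the membership criterion -/

/-- **The bridge.** For `B ⊆ O`, the subring underlying `locAt O B` is the tree's
`locAtCentre B.toSubring O = {y / z | y, z ∈ B, O.valuation z = 1}` (`LocalBlowup.lean`): a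
generator `a * s⁻¹` (`s ∈ B ⊆ O`, `s⁻¹ ∈ O`) has `s = 0` (and is `0`) or `s` an `O`-unit, and
conversely `y / z = y * z⁻¹` with `z⁻¹ ∈ O`. [cite: NovacoskiSpivakovsky2014, Def. 2.8] -/
theorem locAt_toSubring_eq_locAtCentre (O : ValuationSubring K) (B : Subalgebra k K)
    (h : B.toSubring ≤ O.toSubring) :
    (locAt O B).toSubring = locAtCentre B.toSubring O := by
  -- adapted from `coe_risoLoc_eq_locAtCentre` (Theorems/RisoStrataRisoGlobalisationCentres.lean)
  let L : Subalgebra k K :=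
    { locAtCentre B.toSubring O with
      algebraMap_mem' := fun c => le_locAtCentre _ O (B.algebraMap_mem c) }
  apply le_antisymm
  · have hle : locAt O B ≤ L := by
      refine Algebra.adjoin_le ?_
      rintro _ ⟨a, ha, s, hs, hsO, rfl⟩
      change a * s⁻¹ ∈ locAtCentre B.toSubring O
      by_cases hs0 : s = 0
      · rw [hs0, inv_zero, mul_zero]; exact Subring.zero_mem _
      · exact mem_locAtCentre_iff.mpr ⟨a, ha, s, hs,
          valuation_eq_one_of_inv_mem O (h hs) hsO hs0, by rw [div_eq_mul_inv]⟩
    intro x hx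
    exact hle hx
  · rintro x ⟨a, ha, s, hs, hv, rfl⟩
    change a / s ∈ locAt O B
    rw [div_eq_mul_inv]
    exact mul_inv_mem_locAt O B ha hs (inv_mem_of_valuation_eq_one O hv)

/-- **Membership in `locAt O B`** (`B ⊆ O`): the fractions `a * s⁻¹` with `a, s ∈ B` and `s` an
`O`-unit, `O.valuation s = 1`. [cite: NovacoskiSpivakovsky2014, Def. 2.8] -/
theorem mem_locAt_iff (O : ValuationSubring K) (B : Subalgebra k K)
    (h : B.toSubring ≤ O.toSubring) {y : K} :
    y ∈ locAt O B ↔ ∃ a ∈ B, ∃ s ∈ B, O.valuation s = 1 ∧ y = a * s⁻¹ := by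
  rw [← Subalgebra.mem_toSubring, locAt_toSubring_eq_locAtCentre O B h, mem_locAtCentre_iff]
  simp only [Subalgebra.mem_toSubring, div_eq_mul_inv]

/-- `locAt O B ⊆ O` for `B ⊆ O`. [folklore] -/
theorem locAt_le (O : ValuationSubring K) (B : Subalgebra k K) (h : B.toSubring ≤ O.toSubring) :
    (locAt O B).toSubring ≤ O.toSubring := by
  rw [locAt_toSubring_eq_locAtCentre O B h]
  exact locAtCentre_le h

/-- An `O`-unit of `locAt O B` (`B ⊆ O`) is inverted in `locAt O B`. [folklore] -/
theorem inv_mem_locAt (O : ValuationSubring K) (B : Subalgebra k K)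
    (h : B.toSubring ≤ O.toSubring) {y : K} (hy : y ∈ locAt O B) (hv : O.valuation y = 1) :
    y⁻¹ ∈ locAt O B := by
  rw [← Subalgebra.mem_toSubring, locAt_toSubring_eq_locAtCentre O B h] at hy ⊢
  exact inv_mem_locAtCentre hy hv

/-- `locAt` is monotone in the valuation ring along coarsenings: for `B ⊆ O ≤ O₁`,
`locAt O B ≤ locAt O₁ B` (`O`-units of `B` are `O₁`-units). [folklore] -/
theorem locAt_le_locAt_of_le (O O₁ : ValuationSubring K) (hO : O ≤ O₁) (B : Subalgebra k K)
    (h : B.toSubring ≤ O.toSubring) : locAt O B ≤ locAt O₁ B := by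
  intro y hy
  rw [mem_locAt_iff O B h] at hy
  obtain ⟨a, ha, s, hs, hv, rfl⟩ := hy
  have h₁ : B.toSubring ≤ O₁.toSubring := fun x hx => hO (h hx)
  exact (mem_locAt_iff O₁ B h₁).mpr ⟨a, ha, s, hs, valuation_eq_one_of_le O O₁ hO hv, rfl⟩

/-- **`locAt O B` is Mathlib's realised localisation at the centre** (`B ⊆ O`, `Frac B = K`):
its carrier is that of `Localization.subalgebra.ofField K (𝔪_O ∩ B).primeCompl _`, the local
ring of `RankOneReductionProofs.lean` (`mem_centreLocalization_iff`). [cite: NovacoskiSpivakovsky2014, Def. 2.8] -/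
theorem coe_locAt_eq_centreLocalization (O : ValuationSubring K) (B : Subalgebra k K)
    (h : B.toSubring ≤ O.toSubring) [IsFractionRing B.toSubring K] :
    ((locAt O B : Subalgebra k K) : Set K) =
      (Localization.subalgebra.ofField K
        ((maximalIdeal O).comap (Subring.inclusion h)).primeCompl
        (Ideal.primeCompl_le_nonZeroDivisors _) : Set K) := by
  ext x
  rw [SetLike.mem_coe, SetLike.mem_coe, mem_locAt_iff O B h, mem_centreLocalization_iff]

/-- The same, as an equality of subrings of `K`. [folklore] -/
theorem locAt_toSubring_eq_centreLocalization (O : ValuationSubring K) (B : Subalgebra k K)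
    (h : B.toSubring ≤ O.toSubring) [IsFractionRing B.toSubring K] :
    (locAt O B).toSubring =
      (Localization.subalgebra.ofField K
        ((maximalIdeal O).comap (Subring.inclusion h)).primeCompl
        (Ideal.primeCompl_le_nonZeroDivisors _)).toSubring :=
  SetLike.coe_injective (coe_locAt_eq_centreLocalization O B h)

/-! ## Local-ring structure and regularity, via the bridge -/

/-- `locAt O B` (`B ⊆ O`) is a local ring. [folklore] -/
theorem isLocalRing_locAt (O : ValuationSubring K) (B : Subalgebra k K)
    (h : B.toSubring ≤ O.toSubring) : IsLocalRing ↥(locAt O B) := by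
  haveI := isLocalRing_locAtCentre h
  exact (RingEquiv.subringCongr (locAt_toSubring_eq_locAtCentre O B h)).symm.isLocalRing

/-- Regularity of `locAt O B` (`B ⊆ O`) is regularity of `locAtCentre B.toSubring O`. [folklore] -/
theorem isRegularLocalRing_locAt_iff (O : ValuationSubring K) (B : Subalgebra k K)
    (h : B.toSubring ≤ O.toSubring) :
    IsRegularLocalRing ↥(locAt O B) ↔ IsRegularLocalRing ↥(locAtCentre B.toSubring O) := by
  let e := RingEquiv.subringCongr (locAt_toSubring_eq_locAtCentre O B h)
  exact ⟨fun _ => .of_ringEquiv e, fun _ => .of_ringEquiv e.symm⟩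

/-- Regularity of `locAt O B` (`B ⊆ O`) is regularity of the abstract local ring
`Localization.AtPrime (𝔪_O ∩ B)` of `B` at the centre (the form of `RelLocalUniformization`,
`NovacoskiSpivakovsky2014`). [folklore] -/
theorem isRegularLocalRing_locAt_iff_atPrime (O : ValuationSubring K) (B : Subalgebra k K)
    (h : B.toSubring ≤ O.toSubring) :
    IsRegularLocalRing ↥(locAt O B) ↔
      IsRegularLocalRing
        (Localization.AtPrime ((maximalIdeal O).comap (Subring.inclusion h))) := by
  rw [isRegularLocalRing_locAt_iff O B h, isRegularLocalRing_locAtCentre_iff h]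
  rfl

/-! ## The registered stub -/

/-- **STUB `stub_locAt_locAt`.** Localising at the centre of `O` and then at the centre of a
coarsening `O₁ ⊇ O` is localising at the centre of `O₁`: for `B ⊆ O`,
`locAt O₁ (locAt O B) = locAt O₁ B` (`(B_𝔪)_𝔭 = B_𝔭` inside `K`; with `O₁ = O` this is the
idempotence of `locAt O`). Proof: `⊇` by monotonicity in the model (`self_le_locAt`); `⊆`: an
element is `x * t⁻¹` with `x, t ∈ locAt O B ≤ locAt O₁ B` and `t` an `O₁`-unit, inverted in
`locAt O₁ B`. (The hypothesis `k ⊆ O` is implied by `B ⊆ O` and not used.)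
[cite: NovacoskiSpivakovsky2014, Lemma 2.5 (1)] -/
theorem stub_locAt_locAt : ∀ (k K : Type) [Field k] [Field K] [Algebra k K]
    (O O₁ : ValuationSubring K) (B : Subalgebra k K), (∀ c : k, algebraMap k K c ∈ O) → O ≤ O₁ →
      B.toSubring ≤ O.toSubring → locAt O₁ (locAt O B) = locAt O₁ B := by
  intro k K _ _ _ O O₁ B _hk hO h
  apply le_antisymm
  · have hB₁ : B.toSubring ≤ O₁.toSubring := fun x hx => hO (h hx)
    have hL₁ : (locAt O B).toSubring ≤ O₁.toSubring := fun x hx => hO (locAt_le O B h hx)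
    intro y hy
    rw [mem_locAt_iff O₁ (locAt O B) hL₁] at hy
    obtain ⟨x, hx, t, ht, hv, rfl⟩ := hy
    exact mul_mem (locAt_le_locAt_of_le O O₁ hO B h hx)
      (inv_mem_locAt O₁ B hB₁ (locAt_le_locAt_of_le O O₁ hO B h ht) hv)
  · exact locAt_mono O₁ (self_le_locAt O B)

/-- Idempotence of `locAt O` on models `B ⊆ O` (the case `O₁ = O`). [cite: NovacoskiSpivakovsky2014, Lemma 2.5 (2)] -/
theorem locAt_locAt (O : ValuationSubring K) (B : Subalgebra k K) (h : B.toSubring ≤ O.toSubring) :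
    locAt O (locAt O B) = locAt O B :=
  stub_locAt_locAt k K O O B (fun c => h (B.algebraMap_mem c)) le_rfl h

end Summit.ResolutionOfSingularities.ResolutionOfSingularities.Theorems.SyzygyFlattening

end
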